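import Literature.Geometry.Kaehler.ComplexTorusMixedHodgeIndexAllDegrees
import HarnessLib

/-!
# Cattani's key lemma for the mixed hard Lefschetz theorem on a complex torus:
# `ker(L_{ω_1} ⋯ L_{ω_r}) ⊂ W_{r-1}` — the mixed Lefschetz operator is injective on `Hᵏ(X, ℂ)` in EVERY degree
# `k ≤ g - r`, not only in the critical degree `k = g - r` (Cattani 2008, Lemma 4.1)

Layer `Literature/Geometry/Kaehler`, namespace `Literature.Geometry.Kaehler.ComplexTorus`; lane `lit-hodgefound`
(Track 2 foundations library, Layer A: Hodge theory of complex tori on invariant forms), seat p16, generation 26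
(row g26-#4). Sequel of g26-#1 `ComplexTorusMixedHodgeIndexAllDegrees` (`mixedHardLefschetz_total_of_pos`: for positive
real `(1,1)`-forms `θ_1, …, θ_r` on `E` with `dim_ℂ E = r + k` — the CRITICAL degree — and any complex `k`-form `A`,
`(-θ_1)_ℂ ∧ ⋯ ∧ (-θ_r)_ℂ ∧ A = 0 ⇒ A = 0`; Cattani's Thm. 1.3 / 4.2) and of the graded ring of forms
`Literature.LinearAlgebra.Alternating.GradedFormsRing` (`GForm V A`, `GForm.of k η`, `of k η * of l ψ = of (k+l) (η ∧ ψ)`,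
even-degree elements central).

## The source, verbatim

E. Cattani, *Mixed Lefschetz theorems and Hodge–Riemann bilinear relations*, IMRN 2008 (arXiv:0707.1352), held
`paper:arxiv-0707.1352`, §4 p. 10 L6–L28: "**Lemma 4.1.** Let `(V_*, Q, 𝔤_a, N_0)` be a polarized Hodge-Lefschetz module
of weight `k` and `𝒞` its polarizing cone. Let `W_*` denote the filtration defined by the grading `V_*`. Let
`T_1, …, T_m ∈ 𝒞`, `m ≤ k`. Then `ker(T_1 ⋯ T_m) ⊂ W_{m-1} = ⊕_{ℓ ≤ m-1} V_ℓ`. *Proof.* We prove the statement by induction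
on `m`. For `m = 1` the result follows from the assumption that `T_1` satisfies the Lefschetz property relative to `V_*`.
Let now `Ṽ = V / ker(T_2 ⋯ T_m) ≅ T_2 ⋯ T_m · V`. Since `(V_*, Q, 𝔤_a, T_1)` is also a polarized Hodge-Lefschetz module
with the same polarizing cone, it follows from Corollary 3.3 that `(Ṽ_*, Q̃, 𝔤̃_a, T̃_1)` is a polarized Hodge-Lefschetz
module of weight `k - m + 1`. Hence, `ker(T̃_1) ⊂ W̃_0` which implies that `ker(T_1 ⋯ T_m) ⊂ W_{m-1} + ker(T_2 ⋯ T_m)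
⊂ W_{m-1}` since `ker(T_2 ⋯ T_m) ⊂ W_{m-2} ⊂ W_{m-1}` by inductive hypothesis. □"; §2 p. 5 L98: "`W_ℓ := ⊕_{a ≤ ℓ} (V_a)_ℂ`";
§2 Example p. 5: "Let `X` be a `k`-dimensional smooth compact manifold and `V := H^*(X, ℝ)`. We let `V_ℓ := H^{k-ℓ}(X, ℝ)`
[…] Every cohomology class `ω ∈ H^{1,1}(X) ∩ H²(X, ℝ)` defines, by cup product, an element `L_ω ∈ End_{-2}(V_*)` […]
if we let `𝔤_a` denote `H^{1,1}(X) ∩ H²(X, ℝ)` acting by multiplication on `V` then for any class `ω`,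
`(V_*, Q, 𝔤_a, L_ω)`, is a polarized Hodge-Lefschetz module of weight `k`"; §4 **Thm. 4.2**: "Let `T_1, …, T_m ∈ 𝒞`,
`m ≤ k`. Then, the map `T_1 ⋯ T_m : V_m → V_{-m}` is an isomorphism. *Proof.* By Lemma 4.1, the map `T_1 ⋯ T_m : V_m →
V_{-m}` is `1:1`. Since `dim V_m = dim V_{-m}`, the result follows."

Read for the cohomology algebra of a complex torus `X = E/Φ(ℤ^ι)` of dimension `g` (Cattani's `k`), `V_ℓ = H^{g-ℓ}(X)`,
`W_{r-1} = ⊕_{deg ≥ g-r+1} H^{deg}(X)`: **`L_{ω_1} ⋯ L_{ω_r}` kills no non-zero class of degree `≤ g - r`.** The proof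
here is not Cattani's induction through the Descent Lemma but the elementary reduction the torus allows: pad the
monomial `ω_1 ∧ ⋯ ∧ ω_r` by `g - r - k` further copies of the Kähler class `ω_1` (a positive tuple again), so that the
padded operator sits in the critical degree, where g26-#1's `mixedHardLefschetz_total_of_pos` (Timorin's theorem on the
torus, type by type) applies; `ω' ∧ ⋯ ∧ ω' ∧ (ω_1 ∧ ⋯ ∧ ω_r ∧ A) = 0` whenever `ω_1 ∧ ⋯ ∧ ω_r ∧ A = 0` (divisibility in
the graded-commutative ring of forms).

## Contents (theorems only; no `sorry`, no definition, no named fact, net debt 0)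

* §1 Divisibility: `wedgeFamily_append_wedge_eq_zero_of_right` / `_of_left` (`Ω_η ∧ A = 0` or `Ω_{η'} ∧ A = 0 ⇒
  Ω_{η ⧺ η'} ∧ A = 0`), `mixedPrimitiveForms_le_of_append_left/right` (kernels grow with the monomial).
* §2 Positive tuples: `append_mem_positiveTuples`, `ofRealForm_neg_append`.
* §3 **`mixedHardLefschetz_of_pos_of_le`** — CATTANI'S KEY LEMMA 4.1 ON THE TORUS, degree by degree: `dim_ℂ E = g`,
  `k + r ≤ g`, `s ∈ positiveTuples E r`, `A ∈ Hᵏ(X, ℂ)`, `(-s_1)_ℂ ∧ ⋯ ∧ (-s_r)_ℂ ∧ A = 0 ⇒ A = 0`; the packaged forms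
  `mixedLefschetz_injective_of_le` (T2's linear map `mixedLefschetz` is injective), `ker_mixedLefschetz_eq_bot_of_le`,
  `mixedPrimitiveForms_eq_bot_of_le` (no non-zero class of degree `k ≤ g - r` is killed by an `r`-fold positive monomial),
  `finrank_range_mixedLefschetz_of_le` (`rank = C(2g, k)`), the real-class version `mixedHardLefschetz_real_of_le`.
* §4 **`apply_eq_zero_of_of_wedgeFamily_mul_eq_zero`** — LEMMA 4.1 AS PRINTED, on the total space
  `V = H^*(X, ℂ) = GForm E ℂ`: if `of(Ω_s) · w = 0` in the ring of forms then every homogeneous component `w_k` with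
  `k ≤ g - r` vanishes, i.e. `ker(L_{ω_1} ⋯ L_{ω_r}) ⊂ W_{r-1} = ⊕_{k > g-r} Hᵏ(X, ℂ)`
  (`of_wedgeFamily_mul_apply`: the degree-`(2r+k)` component of `of(Ω_s) · w` is `Ω_s ∧ w_k`).

Not here: Cattani's Thm. 1.3 surjectivity half above the critical degree (`k + r > g`), which on the torus is the
transpose of §3 under Poincaré duality; the Descent Lemma itself.

## References

* [Cattani2008MixedLefschetz] E. Cattani, *Mixed Lefschetz theorems and Hodge–Riemann bilinear relations*, Int. Math.
  Res. Not. IMRN 2008, no. 10 (arXiv:0707.1352), §2 (the filtration `W_ℓ`, Example), §4 Lemma 4.1, Thm. 4.2, Thm. 1.3.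
* [DinhNguyen2006] T.-C. Dinh, V.-A. Nguyên, *The mixed Hodge–Riemann bilinear relations for compact Kähler manifolds*,
  GAFA 16 (2006), §1 Theorem B (mixed hard Lefschetz), §2 Prop. 2.1 (a) (arXiv PDF pp. 4–5).
* [Timorin1998] V. A. Timorin, *Mixed Hodge–Riemann bilinear relations in a linear context*, Funct. Anal. Appl. 32
  (1998), Main Theorem — cite-only.
* [Warner1983] F. Warner, *Foundations of Differentiable Manifolds and Lie Groups* (GTM 94), 2.6 (the graded-commutative
  algebra of forms).
* [Lange2023AbelianVarietiesComplex] H. Lange, *Abelian Varieties over the Complex Numbers* (2023), §1.1.5 Thm. 1.1.21,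
  §7.3.1 (monomials of `2`-forms).
-/

noncomputable section

open scoped ComplexConjugate ComplexOrder
open Complex Function Module Finset
open Literature.LinearAlgebra.Alternating
open Literature.Analysis.Complex (oneForm₀ IsOfTypeAt typeSubmodule isOfTypeAt_of_mem_typeSubmodule finrank_typeSubmodule
  typeProjAt typeProjₗ typeProjₗ_apply isOfTypeAt_typeProjAt typeProjAt_zero typeProjAt_of_ne sum_antidiagonal_typeProjAt
  finrank_alt_real_complex)

namespace Literature.Geometry.Kaehler

namespace ComplexTorus

universe u

/-! ## §1 Divisibility in the graded ring of forms: kernels grow with the monomial -/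

section Divisibility

variable {E : Type u} [NormedAddCommGroup E] [NormedSpace ℂ E]

/-- **`Ω_{η'} ∧ A = 0 ⇒ Ω_{η ⧺ η'} ∧ A = 0`**: in the ring of forms `of(Ω_{η ⧺ η'} ∧ A) = of(Ω_η) · of(Ω_{η'}) · of(A) =
of(Ω_η) · of(Ω_{η'} ∧ A) = 0`. [cite: Warner1983, 2.6] [cite: Lange2023AbelianVarietiesComplex, §7.3.1] -/
theorem wedgeFamily_append_wedge_eq_zero_of_right {p q k : ℕ} (η : Fin p → E [⋀^Fin 2]→L[ℝ] ℂ)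
    (η' : Fin q → E [⋀^Fin 2]→L[ℝ] ℂ) {A : E [⋀^Fin k]→L[ℝ] ℂ} (h : (wedgeFamily q η').wedge A = 0) :
    (wedgeFamily (p + q) (Fin.append η η')).wedge A = 0 := by
  apply GForm.of_injective (2 * (p + q) + k)
  rw [GForm.of_zero, ← GForm.of_mul_of, wedgeFamily_append, GForm.of_domDomCongr_finCongr, ← GForm.of_mul_of,
    mul_assoc, GForm.of_mul_of (2 * q), h, GForm.of_zero, mul_zero]

/-- **`Ω_η ∧ A = 0 ⇒ Ω_{η ⧺ η'} ∧ A = 0`**: the even-degree element `of(Ω_{η'})` is central, so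
`of(Ω_η) · of(Ω_{η'}) · of(A) = of(Ω_η ∧ A) · of(Ω_{η'}) = 0`. [cite: Warner1983, 2.6] [cite: Lange2023AbelianVarietiesComplex, §7.3.1] -/
theorem wedgeFamily_append_wedge_eq_zero_of_left {p q k : ℕ} (η : Fin p → E [⋀^Fin 2]→L[ℝ] ℂ)
    (η' : Fin q → E [⋀^Fin 2]→L[ℝ] ℂ) {A : E [⋀^Fin k]→L[ℝ] ℂ} (h : (wedgeFamily p η).wedge A = 0) :
    (wedgeFamily (p + q) (Fin.append η η')).wedge A = 0 := by
  apply GForm.of_injective (2 * (p + q) + k)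
  rw [GForm.of_zero, ← GForm.of_mul_of, wedgeFamily_append, GForm.of_domDomCongr_finCongr, ← GForm.of_mul_of,
    mul_assoc, GForm.of_mul_comm_of_even (even_two_mul q) (wedgeFamily q η') (GForm.of k A), ← mul_assoc,
    GForm.of_mul_of (2 * p), h, GForm.of_zero, zero_mul]

/-- Hence **`P_{η'} ⊆ P_{η ⧺ η'}`**: the mixed primitive space of T2 (`mixedPrimitiveForms Θ m = ker(Ω_Θ ∧ ·)`) grows when
the monomial is padded on the left. [cite: Cattani2008MixedLefschetz, §4 proof of Lemma 4.1 (`ker(T_2 ⋯ T_m) ⊂ ker(T_1 ⋯ T_m)`)] -/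
theorem mixedPrimitiveForms_le_append_of_right {p q m : ℕ} (η : Fin p → E [⋀^Fin 2]→L[ℝ] ℂ)
    (η' : Fin q → E [⋀^Fin 2]→L[ℝ] ℂ) :
    mixedPrimitiveForms η' m ≤ mixedPrimitiveForms (Fin.append η η') m := fun _ hA ↦
  (mem_mixedPrimitiveForms_iff _ _).2
    (wedgeFamily_append_wedge_eq_zero_of_right η η' ((mem_mixedPrimitiveForms_iff _ _).1 hA))

/-- And **`P_η ⊆ P_{η ⧺ η'}`** (padding on the right). [cite: Cattani2008MixedLefschetz, §4 proof of Lemma 4.1] -/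
theorem mixedPrimitiveForms_le_append_of_left {p q m : ℕ} (η : Fin p → E [⋀^Fin 2]→L[ℝ] ℂ)
    (η' : Fin q → E [⋀^Fin 2]→L[ℝ] ℂ) :
    mixedPrimitiveForms η m ≤ mixedPrimitiveForms (Fin.append η η') m := fun _ hA ↦
  (mem_mixedPrimitiveForms_iff _ _).2
    (wedgeFamily_append_wedge_eq_zero_of_left η η' ((mem_mixedPrimitiveForms_iff _ _).1 hA))

end Divisibility

/-! ## §2 Appending positive tuples -/

section PositiveAppend

variable {E : Type u} [NormedAddCommGroup E] [NormedSpace ℂ E]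

/-- Appending two tuples of positive real `(1,1)`-forms gives a positive tuple. [cite: DinhNguyen2006, §2 Prop. 2.1 (arXiv PDF p. 5)] -/
theorem append_mem_positiveTuples {p q : ℕ} {s : Fin p → E [⋀^Fin 2]→L[ℝ] ℝ} {u : Fin q → E [⋀^Fin 2]→L[ℝ] ℝ}
    (hs : s ∈ positiveTuples E p) (hu : u ∈ positiveTuples E q) : Fin.append s u ∈ positiveTuples E (p + q) := by
  intro j
  refine Fin.addCases (fun i ↦ ?_) (fun i ↦ ?_) j
  · rw [Fin.append_left]; exact hs i
  · rw [Fin.append_right]; exact hu i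

/-- Complexifying (and negating) commutes with appending. [folklore] -/
private theorem ofRealForm_neg_append {p q : ℕ} (s : Fin p → E [⋀^Fin 2]→L[ℝ] ℝ) (u : Fin q → E [⋀^Fin 2]→L[ℝ] ℝ) :
    (fun j ↦ ofRealForm (-(Fin.append s u j))) =
      Fin.append (fun j ↦ ofRealForm (-(s j))) (fun j ↦ ofRealForm (-(u j))) := by
  funext j
  refine Fin.addCases (fun i ↦ ?_) (fun i ↦ ?_) j
  · simp only [Fin.append_left]
  · simp only [Fin.append_right]

end PositiveAppend

/-! ## §3 Cattani's key lemma on the torus: injectivity of `L_{ω_1} ⋯ L_{ω_r}` on `Hᵏ(X, ℂ)` for every `k ≤ g - r` -/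

section KeyLemma

variable {E : Type u} [NormedAddCommGroup E] [NormedSpace ℂ E] [FiniteDimensional ℂ E]

/-- **Cattani's Lemma 4.1 for a complex torus, degree by degree: `L_{ω_1} ⋯ L_{ω_r}` is injective on `Hᵏ(X, ℂ)` for
EVERY `k ≤ g - r`** ("`ker(T_1 ⋯ T_m) ⊂ W_{m-1} = ⊕_{ℓ ≤ m-1} V_ℓ`", `V_ℓ = H^{g-ℓ}(X)`): for positive real `(1,1)`-forms
`s_1, …, s_r` on `E`, `dim_ℂ E = g`, `k + r ≤ g`, and any complex `k`-form `A`, `(-s_1)_ℂ ∧ ⋯ ∧ (-s_r)_ℂ ∧ A = 0 ⇒ A = 0`.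
Proof: for `r = 0` the monomial is `1`; for `r ≥ 1` pad the monomial with `g - r - k` copies of `ω_1 = -s_1` (a positive
tuple of length `g - k`, the critical one for degree `k`); the padded monomial still kills `A` (§1), so g26-#1's
critical-degree theorem `mixedHardLefschetz_total_of_pos` gives `A = 0`. [cite: Cattani2008MixedLefschetz, §4 Lemma 4.1 and Thm. 4.2 (proof: "By Lemma 4.1, the map `T_1 ⋯ T_m : V_m → V_{-m}` is `1:1`")]
[cite: DinhNguyen2006, §1 Theorem B and §2 Prop. 2.1 (a) (arXiv PDF pp. 4–5)] [cite: Timorin1998, Main Theorem] -/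
theorem mixedHardLefschetz_of_pos_of_le {g r k : ℕ} (hg : finrank ℂ E = g) (hkr : k + r ≤ g)
    {s : Fin r → E [⋀^Fin 2]→L[ℝ] ℝ} (hs : s ∈ positiveTuples E r) {A : E [⋀^Fin k]→L[ℝ] ℂ}
    (h0 : (wedgeFamily r fun j ↦ ofRealForm (-(s j))).wedge A = 0) : A = 0 := by
  rcases Nat.eq_zero_or_pos r with rfl | hr
  · exact eq_zero_of_wedgeFamily_zero_wedge_eq_zero _ h0
  · obtain ⟨m, hm⟩ : ∃ m, g = (m + r) + k := ⟨g - r - k, by omega⟩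
    have h0' : (wedgeFamily (m + r) fun j ↦ ofRealForm (-(Fin.append (fun _ : Fin m ↦ s ⟨0, hr⟩) s j))).wedge A = 0 := by
      rw [ofRealForm_neg_append]
      exact wedgeFamily_append_wedge_eq_zero_of_right _ _ h0
    exact mixedHardLefschetz_total_of_pos (hg.trans hm)
      (append_mem_positiveTuples (const_mem_positiveTuples (hs ⟨0, hr⟩).1 (hs ⟨0, hr⟩).2 m) hs) h0'

/-- **T2's mixed Lefschetz map `L_θ : Hᵏ(X, ℂ) → H^{k+2r}(X, ℂ)` is injective for every `k ≤ g - r`.**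
[cite: Cattani2008MixedLefschetz, §4 Lemma 4.1 and Thm. 4.2] [cite: DinhNguyen2006, §1 Theorem B (arXiv PDF p. 4)] -/
theorem mixedLefschetz_injective_of_le {g r k K : ℕ} (hg : finrank ℂ E = g) (hkr : k + r ≤ g) (hK : 2 * r + k = K)
    {s : Fin r → E [⋀^Fin 2]→L[ℝ] ℝ} (hs : s ∈ positiveTuples E r) :
    Function.Injective (mixedLefschetz (fun j ↦ ofRealForm (-(s j))) (m := k) hK) := by
  rw [injective_iff_map_eq_zero]
  intro A hA
  exact mixedHardLefschetz_of_pos_of_le hg hkr hs ((mixedLefschetz_eq_zero_iff _ hK A).1 hA)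

/-- `ker L_θ = 0` on `Hᵏ(X, ℂ)` for `k ≤ g - r`. [cite: Cattani2008MixedLefschetz, §4 Lemma 4.1] -/
theorem ker_mixedLefschetz_eq_bot_of_le {g r k K : ℕ} (hg : finrank ℂ E = g) (hkr : k + r ≤ g) (hK : 2 * r + k = K)
    {s : Fin r → E [⋀^Fin 2]→L[ℝ] ℝ} (hs : s ∈ positiveTuples E r) :
    LinearMap.ker (mixedLefschetz (fun j ↦ ofRealForm (-(s j))) (m := k) hK) = ⊥ :=
  LinearMap.ker_eq_bot.2 (mixedLefschetz_injective_of_le hg hkr hK hs)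

/-- **No non-zero class of degree `k ≤ g - r` is killed by a positive monomial of length `r`**: T2's mixed primitive
space `P_θ^k = ker(Ω_θ ∧ ·) ∩ Hᵏ(X, ℂ)` is `0` there (primitive classes relative to `ω_1, …, ω_r` live in degrees
`> g - r`; the first interesting degree is `g - r + 1`, T2's `n + (m+2) = g` bookkeeping with `r = n + 1`).
[cite: Cattani2008MixedLefschetz, §4 Lemma 4.1 (`ker(T_1 ⋯ T_m) ∩ V_ℓ = 0` for `ℓ ≥ m`)] -/
theorem mixedPrimitiveForms_eq_bot_of_le {g r k : ℕ} (hg : finrank ℂ E = g) (hkr : k + r ≤ g)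
    {s : Fin r → E [⋀^Fin 2]→L[ℝ] ℝ} (hs : s ∈ positiveTuples E r) :
    mixedPrimitiveForms (fun j ↦ ofRealForm (-(s j))) k = ⊥ := by
  rw [Submodule.eq_bot_iff]
  intro A hA
  exact mixedHardLefschetz_of_pos_of_le hg hkr hs ((mem_mixedPrimitiveForms_iff _ _).1 hA)

/-- **`rank(L_θ : Hᵏ → H^{k+2r}) = dim Hᵏ(X, ℂ) = C(2g, k)`** for `k ≤ g - r`. [cite: Cattani2008MixedLefschetz, §4 Lemma 4.1 and Thm. 4.2]
[cite: Lange2023AbelianVarietiesComplex, §1.1.5 Prop. 1.1.23] -/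
theorem finrank_range_mixedLefschetz_of_le {g r k K : ℕ} (hg : finrank ℂ E = g) (hkr : k + r ≤ g) (hK : 2 * r + k = K)
    {s : Fin r → E [⋀^Fin 2]→L[ℝ] ℝ} (hs : s ∈ positiveTuples E r) :
    finrank ℂ (LinearMap.range (mixedLefschetz (fun j ↦ ofRealForm (-(s j))) (m := k) hK)) = (2 * g).choose k := by
  rw [LinearMap.finrank_range_of_inj (mixedLefschetz_injective_of_le hg hkr hK hs), finrank_alt_real_complex, hg]

/-- **Real classes**: a real `k`-form `α` with `k + r ≤ g` and `(-s_1)_ℂ ∧ ⋯ ∧ (-s_r)_ℂ ∧ α_ℂ = 0` vanishes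
(`L_{ω_1} ⋯ L_{ω_r}` is injective on `Hᵏ(X, ℝ)`, Cattani's real `V`). [cite: Cattani2008MixedLefschetz, §4 Lemma 4.1 and §2 Example (`V = H^*(X, ℝ)`)] -/
theorem mixedHardLefschetz_real_of_le {g r k : ℕ} (hg : finrank ℂ E = g) (hkr : k + r ≤ g)
    {s : Fin r → E [⋀^Fin 2]→L[ℝ] ℝ} (hs : s ∈ positiveTuples E r) {α : E [⋀^Fin k]→L[ℝ] ℝ}
    (h0 : (wedgeFamily r fun j ↦ ofRealForm (-(s j))).wedge (ofRealForm α) = 0) : α = 0 :=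
  ofRealForm_injective ((mixedHardLefschetz_of_pos_of_le hg hkr hs h0).trans ofRealForm_zero.symm)

end KeyLemma

/-! ## §4 Lemma 4.1 as printed: `ker(L_{ω_1} ⋯ L_{ω_r}) ⊂ W_{r-1}` on the total space `H^*(X, ℂ) = GForm E ℂ` -/

section TotalSpace

variable {E : Type u} [NormedAddCommGroup E] [NormedSpace ℂ E]

/-- **The degree-`(n + k)` component of `of_n(Ω) · w` is `Ω ∧ w_k`**: multiplication by a homogeneous element of
degree `n` in the ring of forms acts componentwise as `Ω ∧ ·`. [cite: Warner1983, 2.6 / 2.10] -/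
theorem of_mul_apply_add {n k : ℕ} (Ω : E [⋀^Fin n]→L[ℝ] ℂ) (w : GForm E ℂ) :
    (GForm.of n Ω * w) (n + k) = Ω.wedge (w k) := by
  rw [GForm.mul_apply, Finset.sum_eq_single (n, k)]
  · rw [dif_pos rfl, GForm.of_apply_self, domDomCongr_finCongr_self]
  · intro p hp hne
    by_cases hp1 : p.1 = n
    · exfalso
      apply hne
      have hp2 : p.2 = k := by have := mem_antidiagonal.1 hp; omega
      exact Prod.ext hp1 hp2
    · rw [GForm.of_apply_of_ne hp1]
      split_ifs with h
      · rw [ContinuousAlternatingMap.zero_wedge, domDomCongr_finCongr_zero]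
      · rfl
  · intro h
    exact absurd (mem_antidiagonal.2 (rfl : (n, k).1 + (n, k).2 = n + k)) h

variable [FiniteDimensional ℂ E]

/-- **Cattani's Lemma 4.1 as printed, for a complex torus: `ker(L_{ω_1} ⋯ L_{ω_r}) ⊂ W_{r-1}`.** On the total cohomology
`V = H^*(X, ℂ) = ⊕_k Alt^k_ℝ(E; ℂ)` (the graded ring of forms `GForm E ℂ`, cup product = `∧`), if `w ∈ V` is killed by
the mixed Lefschetz operator, `(-s_1)_ℂ ∧ ⋯ ∧ (-s_r)_ℂ · w = 0`, then every homogeneous component of `w` of degree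
`k ≤ g - r` vanishes — `w ∈ W_{r-1} = ⊕_{ℓ ≤ r-1} V_ℓ = ⊕_{k ≥ g-r+1} Hᵏ(X, ℂ)` (`V_ℓ = H^{g-ℓ}(X)`). Here
`s ∈ positiveTuples E r`, `dim_ℂ E = g`. [cite: Cattani2008MixedLefschetz, §4 Lemma 4.1 and §2 (`W_ℓ := ⊕_{a ≤ ℓ} (V_a)_ℂ`, Example `V_ℓ := H^{k-ℓ}(X, ℝ)`)]
[cite: DinhNguyen2006, §1 Theorem B (arXiv PDF p. 4)] -/
theorem apply_eq_zero_of_of_wedgeFamily_mul_eq_zero {g r : ℕ} (hg : finrank ℂ E = g)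
    {s : Fin r → E [⋀^Fin 2]→L[ℝ] ℝ} (hs : s ∈ positiveTuples E r) {w : GForm E ℂ}
    (hw : GForm.of (2 * r) (wedgeFamily r fun j ↦ ofRealForm (-(s j))) * w = 0) {k : ℕ} (hkr : k + r ≤ g) :
    w k = 0 := by
  have h := congrFun hw (2 * r + k)
  rw [of_mul_apply_add, Pi.zero_apply] at h
  exact mixedHardLefschetz_of_pos_of_le hg hkr hs h

/-- Equivalently: **a total class killed by `L_{ω_1} ⋯ L_{ω_r}` with no components of degree `> g - r` is zero.**
[cite: Cattani2008MixedLefschetz, §4 Lemma 4.1] -/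
theorem eq_zero_of_of_wedgeFamily_mul_eq_zero_of_forall {g r : ℕ} (hg : finrank ℂ E = g)
    {s : Fin r → E [⋀^Fin 2]→L[ℝ] ℝ} (hs : s ∈ positiveTuples E r) {w : GForm E ℂ}
    (hw : GForm.of (2 * r) (wedgeFamily r fun j ↦ ofRealForm (-(s j))) * w = 0) (hW : ∀ k, g < k + r → w k = 0) :
    w = 0 := by
  funext k
  rcases Nat.lt_or_ge g (k + r) with h | h
  · exact hW k h
  · exact apply_eq_zero_of_of_wedgeFamily_mul_eq_zero hg hs hw h

end TotalSpace

end ComplexTorus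

end Literature.Geometry.Kaehler

end
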